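import Literature.Topology.FourManifolds.SurfaceGroupNielsenCoreSeparation
import Literature.Topology.FourManifolds.SurfaceGroupNielsenCoreCuts
import HarnessLib

/-!
# Nielsen's theorem, pillar CORE: no subloop of a double point separates a chain

Topic `Literature/Topology/FourManifolds`.  The statement of `SurfaceGroupNielsenCoreSeparation.lean`
((P2) of the minimal-counterexample form of Zieschang–Vogt–Coldewey, LNM 835, proof of
Thm. 5.3.2: the two ends of a chain lie on the same side of every closed subloop of the closed
path of a potential-minimal configuration) specialised to the subloop `C[a, b)` of a double point
`d : κ.DoublePoint` of `SurfaceGroupNielsenCoreCuts.lean` (`pv C a = pv C b`, `a < b < ℓ`), the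
form consumed by the case analysis of the double point.

## References

* H. Zieschang, E. Vogt, H.-D. Coldewey, *Surfaces and Planar Discontinuous Groups*, LNM 835
  (1980), §5.3 (proof of Thm. 5.3.2, Lemma 5.3.4). [ZieschangVogtColdewey1980]
-/

noncomputable section

namespace Literature.Topology.FourManifolds

open Literature.GroupTheory.CombinatorialGroupTheory List

namespace SurfaceGroup

namespace Config

variable {g : ℕ} {φ : surfaceGen g → SurfaceGroup g}

/-- **No subloop of a double point separates a chain**: for a double point `a < b` of the closed
path of a potential-minimal configuration of an indecomposable, marked non-trivial assignment and
a kernel slot `σ₀`, it is impossible that `kpos σ₀ ∈ [a, b)` and the chain end lies outside.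
[cite: ZieschangVogtColdewey1980, proof of Thm. 5.3.2 and Lemma 5.3.4] -/
theorem DoublePoint.no_separated_chain (κ : Config φ) (hg : 1 ≤ g) (hI : Indecomposable φ)
    (hM : MarkedNontrivial φ) (hmin : κ.IsMin) (d : κ.DoublePoint) {σ₀ : ℕ × ℕ}
    (hσ₀ : CycFactors.IsKernelSlot κ.U σ₀) :
    ¬ (d.a ≤ CycFactors.kpos κ.U σ₀ ∧ CycFactors.kpos κ.U σ₀ < d.b ∧
      ¬ (d.a ≤ CycFactors.kpos κ.U (CycFactors.chainEnd κ.U κ.bar σ₀) ∧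
        CycFactors.kpos κ.U (CycFactors.chainEnd κ.U κ.bar σ₀) < d.b)) :=
  κ.no_separated_chain hg hI hM hmin hσ₀ d.lt_length.le (DoublePoint.proj_mk_slice κ d)

/-- **The two ends of every chain lie on the same side of a double point.**
[cite: ZieschangVogtColdewey1980, proof of Thm. 5.3.2 and Lemma 5.3.4] -/
theorem DoublePoint.kpos_mem_iff_of_chainEnd (κ : Config φ) (hg : 1 ≤ g) (hI : Indecomposable φ)
    (hM : MarkedNontrivial φ) (hmin : κ.IsMin) (d : κ.DoublePoint) :
    ∀ σ : ℕ × ℕ, CycFactors.IsKernelSlot κ.U σ → σ.1 < κ.w.length →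
      ((d.a ≤ CycFactors.kpos κ.U σ ∧ CycFactors.kpos κ.U σ < d.b) ↔
        (d.a ≤ CycFactors.kpos κ.U (CycFactors.chainEnd κ.U κ.bar σ) ∧
          CycFactors.kpos κ.U (CycFactors.chainEnd κ.U κ.bar σ) < d.b)) :=
  κ.kpos_mem_iff_of_chainEnd hg hI hM hmin d.lt_length.le (DoublePoint.proj_mk_slice κ d)

end Config

end SurfaceGroup

end Literature.Topology.FourManifolds

end
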